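import Literature.NumberTheory.Primality.SmoothNumbersLowerBound
import Literature.NumberTheory.Primality.PrattCertificates
import Mathlib.FieldTheory.Finite.Basic
import Mathlib.Algebra.Polynomial.Roots
import HarnessLib

/-!
# The Fellows–Koblitz deterministic primality test given the factorisation of `p − 1`

Pratt's certificates (`PrattCertificates.lean`) contain a *choice* (a primitive root), so they are
not unique. Fellows–Koblitz (1992, Lemma 1) observed that, given the complete list of prime factors
`q₁, …, q_r` of `p − 1`, primality of `p` is decided *deterministically* in polynomial time: for each
`2 ≤ j ≤ B` (`B = (log p)^{O(1)}`) compute the exact order `h_j` of `j` modulo `p` — `j^{h_j} ≡ 1` and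
`gcd(j^{h_j/q} − 1, p) = 1` for the primes `q ∣ h_j`, which forces the order of `j` modulo *every*
prime `l ∣ p` to be `h_j` — and let `h = lcm h_j`; then `h ∣ l − 1` for every prime `l ∣ p`, so
`h ≥ √p` proves `p` prime, while for a prime `p` the `B`-smooth numbers below `p` are `> √p` roots of
`X^h − 1`, forcing `h > √p`. Consequently the recursive complete factorisations form a **unique**
certificate of primality (used for `FACT ∈ UP ∩ coUP`, `Computability/QuantumComplexity/FactoringUP*.lean`).

This file is the arithmetic of one line of the test, in the sub-namespace `FK`, in the *checking*
form used by the verifier (the table of orders is part of the certificate and is checked, not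
computed):

* `FK.bound p = (size p)^6` (the range `2 ≤ j ≤ bound p` of bases); `FK.lcmList`;
* `FK.EntryOK p qs j h`: `h ∣ p − 1`, `j^h mod p = 1`, and `gcd((j^{h/q} mod p) − 1, p) = 1` for every
  `q ∈ qs` dividing `h`; `FK.EntriesOK p qs j T` (entries `T = [h_j, h_{j+1}, …]`); `FK.TableOK`
  (`|T| = bound p − 1`, entries from `j = 2`);
* **soundness** `FK.prime_of_entriesOK`: if `qs` are primes with `∏ qs = p − 1`, the entries pass and
  `p ≤ (lcm T)²`, then `p` is prime (`FK.eq_orderOf_of_entryOK`: a passing `h` IS the order of `j`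
  modulo every prime `l ∣ p`, whence also **uniqueness** `FK.entriesOK_unique`);
* **completeness** `FK.tableOK_ordTable`, `FK.lt_lcmList_ordTable_sq`: for a prime `p` with
  `size p ≥ 1024` the table of true orders passes and `p < (lcm)²` (smooth numbers:
  `SmoothLB.exists_smooth_finset`, and `X^h − 1` has at most `h` roots in `ZMod p`).

## References

* M. R. Fellows, N. Koblitz, *Self-witnessing polynomial-time complexity and prime factorization*,
  Designs, Codes and Cryptography 2 (1992) 231–235; Proc. 7th Structure in Complexity Theory (1992)
  107–110: Lemma 1 and its proof (held: `paper:doi-10-1007-bf00141967`, p. 3).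
* V. Pratt, *Every prime has a succinct certificate*, SIAM J. Comput. 4 (1975) 214–220.
-/

namespace Literature.NumberTheory.Primality

namespace FK

open Nat

/-! ### The data of the test -/

/-- The range of bases of the test: `j = 2, …, bound p` with `bound p = (size p)^6`
(Fellows–Koblitz: `j ≤ log³ p`; any fixed power of `log p` beyond the smoothness estimate works, we
use the sixth power of the bit size, see `SmoothLB.exists_smooth_finset`). [cite: FellowsKoblitz1992, Lemma 1] -/
def bound (p : ℕ) : ℕ := p.size ^ 6

/-- The least common multiple of a list (`lcm [] = 1`). [folklore] -/
def lcmList : List ℕ → ℕ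
  | [] => 1
  | h :: T => Nat.lcm h (lcmList T)

/-- `lcmList [] = 1`. [folklore] -/
@[simp] theorem lcmList_nil : lcmList [] = 1 := rfl

/-- `lcmList (h :: T) = lcm h (lcmList T)`. [folklore] -/
@[simp] theorem lcmList_cons (h : ℕ) (T : List ℕ) : lcmList (h :: T) = Nat.lcm h (lcmList T) := rfl

/-- Every member divides the lcm. [folklore] -/
theorem dvd_lcmList_of_mem {T : List ℕ} {h : ℕ} (hh : h ∈ T) : h ∣ lcmList T := by
  induction T with
  | nil => simp at hh
  | cons a T ih =>
    rw [lcmList_cons]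
    rcases List.mem_cons.1 hh with rfl | hh
    · exact Nat.dvd_lcm_left _ _
    · exact (ih hh).trans (Nat.dvd_lcm_right _ _)

/-- The lcm divides every common multiple. [folklore] -/
theorem lcmList_dvd {T : List ℕ} {n : ℕ} (hT : ∀ h ∈ T, h ∣ n) : lcmList T ∣ n := by
  induction T with
  | nil => simp
  | cons a T ih =>
    rw [lcmList_cons]
    exact Nat.lcm_dvd (hT a List.mem_cons_self) (ih fun h hh => hT h (List.mem_cons_of_mem _ hh))

/-- The lcm of positive numbers is positive. [folklore] -/
theorem lcmList_pos {T : List ℕ} (hT : ∀ h ∈ T, 0 < h) : 0 < lcmList T := by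
  induction T with
  | nil => simp
  | cons a T ih =>
    rw [lcmList_cons]
    exact Nat.lcm_pos (hT a List.mem_cons_self) (ih fun h hh => hT h (List.mem_cons_of_mem _ hh))

/-- A left fold of `lcm` computes `lcmList` (the verifier folds from the left). [folklore] -/
theorem foldl_lcm_eq (T : List ℕ) (a : ℕ) : T.foldl Nat.lcm a = Nat.lcm a (lcmList T) := by
  induction T generalizing a with
  | nil => simp
  | cons h T ih => rw [List.foldl_cons, ih, lcmList_cons, Nat.lcm_assoc]

/-- **One entry of the table**: `h` passes for the base `j` when `h ∣ p − 1`, `j^h ≡ 1 (mod p)`, and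
for every listed prime `q ∣ h`, `gcd((j^{h/q} mod p) − 1, p) = 1` (Fellows–Koblitz's gcd test, the
case "`= 1`: do nothing"; the cases "`= p`" and "proper factor" both fail here because `h` is already
the exact order). [cite: FellowsKoblitz1992, Lemma 1 (proof)] -/
def EntryOK (p : ℕ) (qs : List ℕ) (j h : ℕ) : Prop :=
  h ∣ p - 1 ∧ j ^ h % p = 1 ∧ ∀ q ∈ qs, q ∣ h → Nat.gcd (j ^ (h / q) % p - 1) p = 1

/-- The entries `T = [h_j, h_{j+1}, …]` pass from the base `j` on. [cite: FellowsKoblitz1992, Lemma 1 (proof)] -/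
def EntriesOK (p : ℕ) (qs : List ℕ) : ℕ → List ℕ → Prop
  | _, [] => True
  | j, h :: T => EntryOK p qs j h ∧ EntriesOK p qs (j + 1) T

/-- **The table of orders passes**: `bound p − 1` entries, for the bases `2, …, bound p`.
[cite: FellowsKoblitz1992, Lemma 1 (proof)] -/
def TableOK (p : ℕ) (qs T : List ℕ) : Prop :=
  T.length = bound p - 1 ∧ EntriesOK p qs 2 T

/-- `EntriesOK` unfolded on a cons. [folklore] -/
@[simp] theorem entriesOK_cons (p : ℕ) (qs : List ℕ) (j h : ℕ) (T : List ℕ) :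
    EntriesOK p qs j (h :: T) ↔ EntryOK p qs j h ∧ EntriesOK p qs (j + 1) T := Iff.rfl

/-- `EntriesOK` on the empty table. [folklore] -/
@[simp] theorem entriesOK_nil (p : ℕ) (qs : List ℕ) (j : ℕ) : EntriesOK p qs j [] := trivial

/-- Membership form of `EntriesOK`: the `i`-th entry passes for the base `j + i`. [folklore] -/
theorem entriesOK_iff_forall (p : ℕ) (qs : List ℕ) : ∀ (j : ℕ) (T : List ℕ),
    EntriesOK p qs j T ↔ ∀ (i : ℕ) (h : ℕ), T[i]? = some h → EntryOK p qs (j + i) h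
  | j, [] => by simp
  | j, h :: T => by
    rw [entriesOK_cons, entriesOK_iff_forall p qs (j + 1) T]
    constructor
    · rintro ⟨h0, hT⟩ i h' hi
      rcases i with _ | i
      · simp at hi; subst hi; simpa using h0
      · simp at hi
        have := hT i h' hi
        rwa [show j + 1 + i = j + (i + 1) by omega] at this
    · intro H
      refine ⟨by simpa using H 0 h (by simp), fun i h' hi => ?_⟩
      have := H (i + 1) h' (by simpa using hi)
      rwa [show j + (i + 1) = j + 1 + i by omega] at this

/-! ### Soundness: a passing entry is the exact order modulo every prime factor -/

/-- Casting a residue modulo `p` further down to a divisor `l ∣ p`. [folklore] -/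
theorem natCast_mod_of_dvd {l p : ℕ} (hlp : l ∣ p) (x : ℕ) : ((x % p : ℕ) : ZMod l) = x := by
  rw [ZMod.natCast_eq_natCast_iff', Nat.mod_mod_of_dvd x hlp]

/-- If `x mod p = 1` then `x = 1` in `ZMod l` for every divisor `l ∣ p`. [folklore] -/
theorem zmod_eq_one_of_mod_eq_one {l p x : ℕ} (hlp : l ∣ p) (h : x % p = 1) : (x : ZMod l) = 1 := by
  rw [← natCast_mod_of_dvd hlp x, h, Nat.cast_one]

/-- **Key lemma** (Fellows–Koblitz: "for any prime `l ∣ p` the same `h_j` is also the exact order of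
`j` modulo `l`, since otherwise we would have found a nontrivial factor of `p`"): if the entry `h`
passes for the base `j`, and `qs` are primes with `∏ qs = p − 1`, then `h` is the order of `j` in
`ZMod l` for every prime `l ∣ p`. [cite: FellowsKoblitz1992, Lemma 1 (proof)] -/
theorem eq_orderOf_of_entryOK {p : ℕ} {qs : List ℕ} {j h : ℕ} (hp : 2 ≤ p)
    (hqs : ∀ q ∈ qs, q.Prime) (hprod : qs.prod = p - 1) (hE : EntryOK p qs j h)
    {l : ℕ} (hl : l.Prime) (hlp : l ∣ p) : h = orderOf (j : ZMod l) := by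
  haveI := Fact.mk hl
  obtain ⟨hdvd, hpow, hgcd⟩ := hE
  have hh0 : h ≠ 0 := by
    rintro rfl
    exact absurd (Nat.eq_zero_of_zero_dvd hdvd) (by omega)
  set a : ZMod l := (j : ZMod l) with ha
  have hah : a ^ h = 1 := by
    have := zmod_eq_one_of_mod_eq_one (l := l) hlp hpow
    simpa [ha] using this
  have hfin : IsOfFinOrder a := isOfFinOrder_iff_pow_eq_one.2 ⟨h, Nat.pos_of_ne_zero hh0, hah⟩
  have hopos : 0 < orderOf a := hfin.orderOf_pos
  have hodvd : orderOf a ∣ h := orderOf_dvd_iff_pow_eq_one.2 hah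
  by_contra hne
  -- `h = o * c` with `c ≥ 2`; a prime `q ∣ c` is a listed prime with `a ^ (h / q) = 1`
  obtain ⟨c, hc⟩ := hodvd
  have hc1 : c ≠ 1 := by rintro rfl; exact hne (by simpa using hc)
  have hc0 : c ≠ 0 := by rintro rfl; simp at hc; exact hh0 hc
  set q := c.minFac with hq
  have hqprime : q.Prime := Nat.minFac_prime hc1
  have hqc : q ∣ c := Nat.minFac_dvd c
  have hqh : q ∣ h := hc ▸ (hqc.mul_left _)
  have hqmem : q ∈ qs := by
    have hq' : q ∣ qs.prod := by rw [hprod]; exact hqh.trans hdvd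
    exact mem_list_primes_of_dvd_prod hqprime.prime (fun r hr => (hqs r hr).prime) hq'
  have hpow' : a ^ (h / q) = 1 := by
    have : h / q = orderOf a * (c / q) := by
      rw [hc, Nat.mul_div_assoc _ hqc]
    rw [this, pow_mul, pow_orderOf_eq_one, one_pow]
  -- the gcd test fails: `l` divides both `p` and `(j^{h/q} mod p) - 1`
  have hg := hgcd q hqmem hqh
  set x := j ^ (h / q) % p with hx
  have hxl : (x : ZMod l) = 1 := by
    rw [hx, natCast_mod_of_dvd hlp, Nat.cast_pow]; exact hpow'
  have hx1 : x % l = 1 := by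
    have := (ZMod.natCast_eq_natCast_iff' x 1 l).1 (by simpa using hxl)
    rwa [Nat.mod_eq_of_lt hl.one_lt] at this
  have hlx : l ∣ x - 1 := by
    have := Nat.div_add_mod x l
    rw [hx1] at this
    exact ⟨x / l, by omega⟩
  have hl1 : l ∣ 1 := by
    rw [← hg]; exact Nat.dvd_gcd hlx hlp
  exact hl.one_lt.ne' (Nat.dvd_one.1 hl1)

/-- A passing entry divides `l − 1` for every prime `l ∣ p` (Fermat in `ZMod l`).
[cite: FellowsKoblitz1992, Lemma 1 (proof)] -/
theorem dvd_sub_one_of_entryOK {p : ℕ} {qs : List ℕ} {j h : ℕ} (hp : 2 ≤ p)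
    (hqs : ∀ q ∈ qs, q.Prime) (hprod : qs.prod = p - 1) (hE : EntryOK p qs j h)
    {l : ℕ} (hl : l.Prime) (hlp : l ∣ p) : h ∣ l - 1 := by
  haveI := Fact.mk hl
  have heq := eq_orderOf_of_entryOK hp hqs hprod hE hl hlp
  have hh0 : h ≠ 0 := by
    rintro rfl
    exact absurd (Nat.eq_zero_of_zero_dvd hE.1) (by omega)
  have hah : (j : ZMod l) ^ h = 1 := by
    have := zmod_eq_one_of_mod_eq_one (l := l) hlp hE.2.1
    simpa using this
  have ha0 : (j : ZMod l) ≠ 0 := by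
    intro h0
    rw [h0, zero_pow hh0] at hah
    exact zero_ne_one hah
  rw [heq]
  exact ZMod.orderOf_dvd_card_sub_one ha0

/-- All passing entries divide `l − 1`, hence so does their lcm. [cite: FellowsKoblitz1992, Lemma 1 (proof)] -/
theorem lcmList_dvd_sub_one_of_entriesOK {p : ℕ} {qs : List ℕ} (hp : 2 ≤ p)
    (hqs : ∀ q ∈ qs, q.Prime) (hprod : qs.prod = p - 1) {l : ℕ} (hl : l.Prime) (hlp : l ∣ p) :
    ∀ {j : ℕ} {T : List ℕ}, EntriesOK p qs j T → lcmList T ∣ l - 1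
  | j, [], _ => by simp
  | j, h :: T, hE => by
    rw [lcmList_cons]
    exact Nat.lcm_dvd (dvd_sub_one_of_entryOK hp hqs hprod hE.1 hl hlp)
      (lcmList_dvd_sub_one_of_entriesOK hp hqs hprod hl hlp hE.2)

/-- **Soundness of the Fellows–Koblitz test** ("if `h ≥ √p`, then we know that `p` is prime,
because `h ∣ l − 1` for any prime `l ∣ p`"): if `qs` are primes with `∏ qs = p − 1`, the entries pass
(from any base) and `p ≤ (lcm T)²`, then `p` is prime. [cite: FellowsKoblitz1992, Lemma 1] -/
theorem prime_of_entriesOK {p : ℕ} {qs T : List ℕ} {j : ℕ} (hp : 2 ≤ p)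
    (hqs : ∀ q ∈ qs, q.Prime) (hprod : qs.prod = p - 1) (hE : EntriesOK p qs j T)
    (hle : p ≤ lcmList T ^ 2) : p.Prime := by
  by_contra hnp
  set l := p.minFac with hl
  have hlprime : l.Prime := Nat.minFac_prime (by omega)
  have hlp : l ∣ p := Nat.minFac_dvd p
  have hl2 : l ^ 2 ≤ p := Nat.minFac_sq_le_self (by omega) hnp
  have hdvd := lcmList_dvd_sub_one_of_entriesOK hp hqs hprod hlprime hlp hE
  have hle' : lcmList T ≤ l - 1 := Nat.le_of_dvd (by have := hlprime.two_le; omega) hdvd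
  have : lcmList T ^ 2 < l ^ 2 := Nat.pow_lt_pow_left (by have := hlprime.two_le; omega) two_ne_zero
  omega

/-- **Uniqueness of the table**: for a *prime* `p` (and listed primes `qs` with `∏ qs = p − 1`) a
passing entry for the base `j` is the order of `j` modulo `p`; so two passing tables from the same
base with the same length coincide. [cite: FellowsKoblitz1992, Lemma 1 (proof)] -/
theorem entriesOK_unique {p : ℕ} {qs : List ℕ} (hp : p.Prime) (hqs : ∀ q ∈ qs, q.Prime)
    (hprod : qs.prod = p - 1) : ∀ {j : ℕ} {T T' : List ℕ}, EntriesOK p qs j T → EntriesOK p qs j T' →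
    T.length = T'.length → T = T'
  | j, [], [], _, _, _ => rfl
  | j, [], _ :: _, _, _, h => by simp at h
  | j, _ :: _, [], _, _, h => by simp at h
  | j, h :: T, h' :: T', hE, hE', hlen => by
    have e1 := eq_orderOf_of_entryOK hp.two_le hqs hprod hE.1 hp dvd_rfl
    have e2 := eq_orderOf_of_entryOK hp.two_le hqs hprod hE'.1 hp dvd_rfl
    rw [e1, e2, entriesOK_unique hp hqs hprod hE.2 hE'.2 (by simpa using hlen)]

/-! ### Completeness: the table of true orders of a large prime -/

/-- The true table of a prime `p`: the orders of `2, 3, …, bound p` modulo `p`.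
[cite: FellowsKoblitz1992, Lemma 1 (proof)] -/
noncomputable def ordTable (p : ℕ) : List ℕ :=
  (List.range (bound p - 1)).map fun i => orderOf ((i + 2 : ℕ) : ZMod p)

/-- The true table has the right length. [folklore] -/
@[simp] theorem length_ordTable (p : ℕ) : (ordTable p).length = bound p - 1 := by
  simp [ordTable]

/-- `bound p < p` for `size p ≥ 1024` (indeed `(size p)^6 < 2^{size p − 1}`). [folklore] -/
theorem bound_lt {p : ℕ} (hp : 1024 ≤ p.size) : bound p < p := by
  set m := p.size with hm
  set L := m.size with hL
  have hL11 : 11 ≤ L := by rw [hL]; exact Nat.lt_size.2 (le_trans (by norm_num) hp)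
  have hmL : 2 ^ (L - 1) ≤ m := by apply Nat.lt_size.1; rw [← hL]; omega
  have hmL' : m < 2 ^ L := Nat.lt_size_self m
  have hm2L : 2 * L ^ 2 ≤ m := (SmoothLB.two_mul_sq_le_two_pow hL11).trans hmL
  have hpm : 2 ^ (m - 1) ≤ p := by
    apply Nat.lt_size.1; rw [← hm]; omega
  calc bound p = m ^ 6 := rfl
    _ < (2 ^ L) ^ 6 := Nat.pow_lt_pow_left hmL' (by norm_num)
    _ = 2 ^ (6 * L) := by rw [← pow_mul, mul_comm]
    _ ≤ 2 ^ (m - 1) := Nat.pow_le_pow_right two_pos (by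
        have : 6 * L + 1 ≤ m := by nlinarith
        omega)
    _ ≤ p := hpm

/-- **The true entry passes**: for a prime `p`, a base `2 ≤ j < p` and listed numbers `qs` all `≥ 2`,
the order `h` of `j` satisfies `h ∣ p − 1`, `j^h ≡ 1`, and `gcd((j^{h/q} mod p) − 1, p) = 1` for every
`q ∈ qs` dividing `h` (as `j^{h/q} ≢ 1`). [cite: FellowsKoblitz1992, Lemma 1 (proof)] -/
theorem entryOK_orderOf {p : ℕ} (hp : p.Prime) {qs : List ℕ} (hqs : ∀ q ∈ qs, 2 ≤ q) {j : ℕ}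
    (hj2 : 2 ≤ j) (hjp : j < p) : EntryOK p qs j (orderOf (j : ZMod p)) := by
  haveI := Fact.mk hp
  set a : ZMod p := (j : ZMod p) with ha
  have ha0 : a ≠ 0 := by
    rw [ha, Ne, ZMod.natCast_eq_zero_iff]
    exact Nat.not_dvd_of_pos_of_lt (by omega) hjp
  refine ⟨ZMod.orderOf_dvd_card_sub_one ha0, ?_, fun q hq hqh => ?_⟩
  · exact Pratt.mod_eq_one_of_zmod_pow hp.two_le (by rw [← ha]; exact pow_orderOf_eq_one a)
  · have hq2 := hqs q hq
    have hopos : 0 < orderOf a := (ZMod.orderOf_dvd_card_sub_one ha0 |> fun h =>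
      Nat.pos_of_dvd_of_pos h (by have := hp.two_le; omega))
    have hlt : orderOf a / q < orderOf a := Nat.div_lt_self hopos (by omega)
    have hpos : orderOf a / q ≠ 0 := (Nat.div_pos (Nat.le_of_dvd hopos hqh) (by omega)).ne'
    have hne : a ^ (orderOf a / q) ≠ 1 := pow_ne_one_of_lt_orderOf hpos hlt
    set x := j ^ (orderOf a / q) % p with hx
    have hxp : x < p := Nat.mod_lt _ hp.pos
    have hx1 : x ≠ 1 := by
      intro h1
      apply hne
      have : ((x : ℕ) : ZMod p) = a ^ (orderOf a / q) := by
        rw [hx, natCast_mod_of_dvd dvd_rfl, Nat.cast_pow]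
      rw [← this, h1, Nat.cast_one]
    have hx0 : x ≠ 0 := by
      intro h0
      apply pow_ne_zero (orderOf a / q) ha0
      have : ((x : ℕ) : ZMod p) = a ^ (orderOf a / q) := by
        rw [hx, natCast_mod_of_dvd dvd_rfl, Nat.cast_pow]
      rw [← this, h0, Nat.cast_zero]
    -- `gcd (x - 1) p ∈ {1, p}` and it is not `p` since `0 < x - 1 < p`
    rcases (Nat.dvd_prime hp).1 (Nat.gcd_dvd_right (x - 1) p) with h | h
    · exact h
    · exfalso
      have hpx : p ∣ x - 1 := h ▸ Nat.gcd_dvd_left (x - 1) p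
      have := Nat.eq_zero_of_dvd_of_lt hpx (by omega)
      omega

/-- The true table passes from the base `j`: all entries for `j, j + 1, …, j + n − 1 < p`. [folklore] -/
theorem entriesOK_map_orderOf {p : ℕ} (hp : p.Prime) {qs : List ℕ} (hqs : ∀ q ∈ qs, 2 ≤ q) :
    ∀ (n j : ℕ), 2 ≤ j → j + n ≤ p →
      EntriesOK p qs j ((List.range n).map fun i => orderOf ((i + j : ℕ) : ZMod p))
  | 0, j, _, _ => by simp
  | n + 1, j, hj, hjn => by
    rw [List.range_succ_eq_map, List.map_cons, List.map_map, entriesOK_cons]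
    refine ⟨by simpa using entryOK_orderOf hp hqs hj (by omega), ?_⟩
    have := entriesOK_map_orderOf hp hqs n (j + 1) (by omega) (by omega)
    convert this using 2
    funext i
    simp only [Function.comp_apply, Nat.succ_eq_add_one]
    congr 2
    omega

/-- **The true table of a large prime passes.** [cite: FellowsKoblitz1992, Lemma 1 (proof)] -/
theorem tableOK_ordTable {p : ℕ} (hp : p.Prime) (hsz : 1024 ≤ p.size) {qs : List ℕ}
    (hqs : ∀ q ∈ qs, 2 ≤ q) : TableOK p qs (ordTable p) := by
  refine ⟨length_ordTable p, ?_⟩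
  have h1 : 1 ≤ bound p := Nat.one_le_pow 6 p.size (by omega)
  have := entriesOK_map_orderOf hp hqs (bound p - 1) 2 le_rfl (by have := bound_lt hsz; omega)
  simpa [ordTable] using this

/-- Every entry of the true table is the order of some base `2 ≤ j ≤ bound p`, and conversely the
order of every such base is listed. [folklore] -/
theorem mem_ordTable_iff {p h : ℕ} : h ∈ ordTable p ↔ ∃ j, 2 ≤ j ∧ j ≤ bound p ∧ h = orderOf ((j : ℕ) : ZMod p) := by
  simp only [ordTable, List.mem_map, List.mem_range]
  constructor
  · rintro ⟨i, hi, rfl⟩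
    exact ⟨i + 2, by omega, by omega, by simp⟩
  · rintro ⟨j, hj2, hjB, rfl⟩
    exact ⟨j - 2, by omega, by simp [show j - 2 + 2 = j by omega]⟩

/-- The lcm of the true table kills every `bound p`-smooth number below `p`: if all prime factors of
`0 < n` are `≤ bound p` then `n^{lcm} = 1` in `ZMod p`. [cite: FellowsKoblitz1992, Lemma 1 (proof)] -/
theorem pow_lcmList_ordTable_eq_one {p : ℕ} {n : ℕ} (hn : 0 < n)
    (hsmooth : ∀ q ∈ n.primeFactors, q ≤ bound p) :
    ((n : ℕ) : ZMod p) ^ lcmList (ordTable p) = 1 := by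
  -- each prime factor is killed
  have hq : ∀ q ∈ n.primeFactorsList, ((q : ℕ) : ZMod p) ^ lcmList (ordTable p) = 1 := by
    intro q hq
    have hqprime := Nat.prime_of_mem_primeFactorsList hq
    have hqB : q ≤ bound p := hsmooth q (Nat.mem_primeFactors_iff_mem_primeFactorsList.2 hq)
    have hmem : orderOf ((q : ℕ) : ZMod p) ∈ ordTable p :=
      mem_ordTable_iff.2 ⟨q, hqprime.two_le, hqB, rfl⟩
    exact orderOf_dvd_iff_pow_eq_one.1 (dvd_lcmList_of_mem hmem)
  -- hence the product
  have key : ∀ l : List ℕ, (∀ q ∈ l, ((q : ℕ) : ZMod p) ^ lcmList (ordTable p) = 1) →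
      ((l.prod : ℕ) : ZMod p) ^ lcmList (ordTable p) = 1 := by
    intro l
    induction l with
    | nil => intro; simp
    | cons q l ih =>
      intro h
      rw [List.prod_cons, Nat.cast_mul, mul_pow, h q List.mem_cons_self, one_mul]
      exact ih fun r hr => h r (List.mem_cons_of_mem _ hr)
  have := key n.primeFactorsList hq
  rwa [Nat.prod_primeFactorsList hn.ne'] at this

/-- **Completeness of the Fellows–Koblitz test** ("if `h < √p` … the polynomial `X^h − 1` has `> h`
roots in `ℤ/pℤ`, and so `p` is composite"): for a prime `p` with `size p ≥ 1024`, `p < (lcm of the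
true table)²`. [cite: FellowsKoblitz1992, Lemma 1] -/
theorem lt_lcmList_ordTable_sq {p : ℕ} (hp : p.Prime) (hsz : 1024 ≤ p.size) :
    p < lcmList (ordTable p) ^ 2 := by
  haveI := Fact.mk hp
  obtain ⟨S, hcard, hS⟩ := SmoothLB.exists_smooth_finset hsz
  set ℓ := lcmList (ordTable p) with hℓ
  -- `ℓ > 0`: every listed order is the order of a unit
  have hℓpos : 0 < ℓ := by
    apply lcmList_pos
    intro h hh
    obtain ⟨j, hj2, hjB, rfl⟩ := mem_ordTable_iff.1 hh
    have hne : ((j : ℕ) : ZMod p) ≠ 0 := by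
      rw [Ne, ZMod.natCast_eq_zero_iff]
      exact Nat.not_dvd_of_pos_of_lt (by omega) (by have := bound_lt hsz; omega)
    exact Nat.pos_of_dvd_of_pos (ZMod.orderOf_dvd_card_sub_one hne) (by have := hp.two_le; omega)
  -- the residues of `S` are distinct roots of `X^ℓ - 1`
  have hinj : Set.InjOn (fun n : ℕ => (n : ZMod p)) (S : Set ℕ) := by
    intro n hn n' hn' h
    have h1 := (ZMod.natCast_eq_natCast_iff' n n' p).1 h
    rwa [Nat.mod_eq_of_lt (hS n hn).2.1, Nat.mod_eq_of_lt (hS n' hn').2.1] at h1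
  have hsub : S.image (fun n : ℕ => (n : ZMod p)) ⊆ (Polynomial.nthRoots ℓ (1 : ZMod p)).toFinset := by
    intro x hx
    obtain ⟨n, hn, rfl⟩ := Finset.mem_image.1 hx
    rw [Multiset.mem_toFinset, Polynomial.mem_nthRoots hℓpos]
    exact pow_lcmList_ordTable_eq_one (hS n hn).1 (hS n hn).2.2
  have hcardle : S.card ≤ ℓ := by
    calc S.card = (S.image fun n : ℕ => (n : ZMod p)).card := (Finset.card_image_of_injOn hinj).symm
      _ ≤ (Polynomial.nthRoots ℓ (1 : ZMod p)).toFinset.card := Finset.card_le_card hsub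
      _ ≤ Multiset.card (Polynomial.nthRoots ℓ (1 : ZMod p)) := Multiset.toFinset_card_le _
      _ ≤ ℓ := Polynomial.card_nthRoots ℓ 1
  calc p < S.card ^ 2 := hcard
    _ ≤ ℓ ^ 2 := Nat.pow_le_pow_left hcardle 2

end FK

end Literature.NumberTheory.Primality
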